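import Summits.BirchSwinnertonDyer.Rank1Residual.F1Sign2.DescentSignAtTwo
import Literature.NumberTheory.EllipticCurves.HeegnerPoints
import HarnessLib

/-!
# Cell `bsd-f1-sign2` — analytic / Waldspurger–Gross–Zagier lens (seat `-an`) g4, v1.8: **AN-10H — the descent
# sign read by the HEEGNER INDEX (`L`-free)**

STATEMENTS ONLY (two `@[conjecture] def`s with bodies — OPEN obligations of ours, nothing asserted; no `sorry`, no named
fact). Source memo: `HOME/MEMO-an.md` v1.8 (sha16 4975b50527b716dd) §2 AN-10 (v); companion file
`DescentSignShaAtTwo.lean` (AN-10K / AN-10Λ / AN-10K⁼).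

On a descent-admissible imaginary quadratic `K` (Heegner hypothesis automatic), rank `E(ℚ) = 1`, `Ш(E)[2] = 0`,
the Gross–Zagier index identity `#Ш(E/K) = ([E(K) : ℤ y_K] / (c · ∏_ℓ c_ℓ(E)))²` (Gross–Zagier 1986 V.(2.2) =
Gross 1991 Conj. 1.2 — a CONJECTURE at the prime `2`; a theorem at odd `p ∤ N·…` by Kolyvagin / Zhang /
Jetchev–Skinner–Wan; Kolyvagin's `#Ш(E/K) ∣ t_{E/K}·I_K²` (Gross 1991 Thm. 1.3) carries an unspecified power of `2` in
`t_{E/K}` — exactly the residual of crux 19099 `RankOneAtTwo`) turns AN-10K⁼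
(`Ш(E/K)[2] ≅ (ℤ/2)^{2[ε = −1]}`, Kramer-exact, tree `DescentSignIffShaOverAdmissibleField`) into an `L`-FREE reading
of the real-place descent sign `ε(E)` of seat `-desc` (`ε = +1` iff the generator meets the egg, tree `MeetsEgg`):
**`ε(E) = +1` iff the 2-adic valuation of the Heegner index equals that of `c · Tam(E)`; `ε(E) = −1` iff the Heegner
point is 2-divisible beyond Tamagawa.**

* **AN-10H** `DescentSignHeegnerIndexAtTwo` (conjecture-grade; in-print-assembly CONJECTURE at `2` = GZ V.(2.2) ∘ Kramer).
* **AN-10H⁻** `DescentSignHeegnerDivisibilityAtTwo` (the one-sided `ε = −1` half; it is STRONGER than the `←` of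
  AN-10H: it contains the 2-part of the integrality `c·Tam(E) ∣ I_K` (`√#Ш(E/K) ∈ ℤ`), conjectural at `2` — Jetchev 2008's
  global divisibility theorem is for odd `p`, `p ∤ N`, `GL₂`-image; it is NOT a corollary of AN-10H — REF1 §25 remark (2)).

THE INDEX TYPED HERE is the torsion-free one, `I(P) = [E(K) : ℤ P + E(K)_tors]`; it equals Gross's `I_K = [E(K) : ℤ y_K]`
up to the factor `t = #E(K)_tors`, which is ODD on this locus (`E(ℚ)[2] = 0` means the 2-division cubic is irreducible
over `ℚ`, and an irreducible cubic acquires no root in a quadratic field, so `E(K)[2] = 0`); hence `v₂ I(P) = v₂ I_K`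
(REF1 §25 remark (1); numerically `e = [E(K)/tors : E(ℚ)/tors] = 1` on 4 388/4 388 rows).

BC5 WITNESS (MEMO-an §2 AN-10 (v) TABLE H / H′; ENGINE E = `HOME/MEMO-an-data/g4/an12_engineE.py` 6beeb1abe69a2639,
`L`-FREE: `y_K` computed in `ℂ/Λ_E` from the `h(d_K)` Heegner forms and identified against Cremona's Mordell–Weil lattice
at two precisions; kit j288061 rows `g4/an12_rows_quick.json` d3bb246ceae57c1e, kit j287838 rows `g4/an12_rows_full.json`
8b39a49d11597aa9): two-engine check `2(v₂ I_K − v₂ Tam(E)) = v₂ #Ш_an(E/K)` on 182/182 admissible pairs with known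
`L`-values (`d ∈ {−7, −15, −23}`); SIGN LAW `ε = +1 ⇒ v₂ I_K = v₂(c·Tam(E))`, `ε = −1 ⇒ v₂ I_K ≥ v₂(c·Tam(E)) + 1` on
**4 367 / 4 367** admissible pairs (`N ≤ 20 000`, `d_K` down to `−199`, 4 185 of them with no `L`-value input anywhere;
`ε = −1`: 580/580, excess `{1: 434, 2: 116, 3: 14, 4: 4}` in the `N ≤ 20 000` tranche), 0 against; controls (Heegner
but NOT admissible, some `a_q` even): the `ε = +1` law BREAKS on 18/18 ⇒ admissibility is necessary. Anchor: `37a1`,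
`d = −7`: `y_K = (0,0)` = generator (Gross 1991 p. 214), `I = 1 = c·Tam`, `(0,0)` on the egg (`ε = +1`).
CHEAPEST FALSIFIER (run): one admissible pair with `ε = +1` and `I_K/(c·Tam)` even, or `ε = −1` and odd — 0 / 4 367.
WHY NOVEL (MEMO-an §2 (v), search-before-claim both corpora; REF2-PLACEMENT-v12 §2): the 2-adic valuation of Heegner
points as carrier of 2-descent data is printed for CM / `E[2]`-reducible families (Tian 2014 congruent numbers; Kriz–Li
2019 Thm 1.12/5.1, Lemma 5.4, Cor 5.5/5.8 — a printed NON-CM `p = 2` theorem corner on the `ε = +1` side: 2 split in `K`,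
index and Tamagawa odd) and Kolyvagin/Jetchev control `I_K` at odd `p` only; the uniform-in-`K` statement «`I_K/(c·Tam(E))`
odd ⟺ the generator meets the egg, for EVERY admissible `K`» for non-CM `E[2]`-irreducible curves returned no hit
(corpus fts+vec, galaxy `--star all`; nearest Gross–Parson 2011 local divisibility, Burhanuddin 2007 thesis).
REF2 v12 §2 verdict: IN-PRINT-ASSEMBLY, CONJECTURE-grade at `2`; beyond-print theorem: no.

REFUTER VERDICTS: REF1-AUDIT-v1 §25 (sha16 a044f7c6a465caf1; evidence `HOME/REF1-data/b21/`): AN-10H SURVIVES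
conjecture-grade, AN-10H⁻ SURVIVES conjecture-grade; A1 rc 0; BC7 CLEAN ×2; carriers pinned (minimal `W` ⇒ `Dt.c`
Néron-normalised; index `≠ 0` by rank `E(K) = 1` + `¬ IsOfFinAddOrder P`; rescaling-invariant); no C′ needed; the binder
`(W.quadraticTwist d_K).mordellWeilRank = 0` is redundant modulo Kolyvagin (harmless); the binders admit additive-at-2
`W` (correctly: 2 splits in `K`, `Tam(E/K) = Tam(W)²`, Kramer `i₂ = 0`).

TYPER FILING (seat `bsd-f1-sign2-ty` g2; CANDIDATES.md rows AN-10H / AN-10H⁻; D-ty-8): the -an g4 sketch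
`HOME/MEMO-an-data/g4/Sketch_v5c.lean` fc41c3c402c39034 (rc 0, 0 warnings, 0 sorries) re-filed with the two bodies
VERBATIM, tagged `@[conjecture]` (open obligations), docstrings extended by REF1 §25 remarks (1)(2) and the REF2 v12 §2
cites. STATEMENTS ONLY; nothing asserted, no named fact. PARTITION: none moved; beyond-print theorem: no.
bears_on: `stmt-BirchSwinnertonDyer-19099` (`RankOneAtTwo`), via AN-10K⁼ also 19098. -/

noncomputable section

open scoped Classical

namespace Summit.BirchSwinnertonDyer.Rank1Residual.F1Sign2

open Literature.NumberTheory.EllipticCurves Literature.NumberTheory.EllipticCurves.ModularForms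

set_option autoImplicit false

section

/-- **AN-10H `DescentSignHeegnerIndexAtTwo` (conjecture; `L`-free shadow of AN-10K⁼ through Gross–Zagier V.(2.2) at 2).**
Let `W/ℚ` be a globally minimal elliptic curve with `Δ > 0`, `E(ℚ)[2] = 0`, `rank E(ℚ) = 1`, `Ш(E)[2] = 0`; let `K` be an
imaginary quadratic field whose discriminant `d_K` is descent-admissible for `W` (`DescAdmissible`: `d_K ≡ 1 (mod 8)`,
`a_q(E)` odd at the primes `q ∣ d_K`, every odd bad prime split — so `K` satisfies the Heegner hypothesis for `N_E`),
with `rank E^{(d_K)}(ℚ) = 0`; let `P ∈ E(K)` map to the Heegner point `∑_{[Q]} φ(τ_Q)` of a modular parametrisation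
datum `Dt` (Manin constant `Dt.c`) and be of infinite order. Then, writing
`I(P) = [E(K) : ℤ P + E(K)_tors]` (`AddSubgroup.index` of `zmultiples P ⊔ torsion`; `= v₂`-equivalently Gross's `I_K`,
since `#E(K)_tors` is odd here — module docstring):
`MeetsEgg W ↔ v₂ I(P) = v₂ (|Dt.c| · ∏_ℓ c_ℓ(E))`.
Mechanism: GZ + BSD-shape `#Ш(E/K) = (I · #E(K)_tors / (c · ∏_{v} c_v(E/K)^{1/2}))²` with all `ℓ ∣ N` split
(`∏_v c_v(E/K) = Tam(E)²`), `#E(K)_tors` odd (`E(K)[2] = 0`), and AN-10K⁼ (`Ш(E/K)[2] = 0 ⟺ ε = +1` on admissible `K`).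
Census (ENGINE E, `L`-free; MEMO-an §2 AN-10 (v) TABLE H/H′): two-engine `2(v₂ I − v₂ Tam) = v₂ #Ш_an(E/K)` on 182/182;
this iff on 4 367/4 367 admissible pairs (`N ≤ 20 000`, `d_K ∈ {−7,…,−199}`), 0 against; admissibility necessary
(18/18 non-admissible Heegner controls break it). Anchor: `37a1`, `d = −7`: `y_K = (0,0)` = generator (Gross–Zagier),
`I = 1 = Tam`, and `(0,0)` lies on the egg (`ε = +1`). Why it might fail: the 2-part of the Gross–Zagier index conjecture
over `K` (Manin constant, the prime 2 in Kolyvagin's bound) — exactly the residual of crux 19099. Printed neighbours: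
GZ V.(2.2) = Gross 1991 Conj. 1.2 (conjecture, any `p`); Kriz–Li 2019 Thm. 5.1 (non-CM, `ε = +1`-type corner: index and
Tamagawa odd); Kolyvagin / Jetchev 2008 (odd `p`). REF1 §25: SURVIVES conjecture-grade; REF2 v12 §2: in-print-assembly,
conjecture-grade at 2. [cite: GrossZagier1986, V.(2.2)] [cite: Gross1991, (1.1), Conj. 1.2 and Thm. 1.3]
[cite: Kramer1981, Thm. 1, Prop. 7] [cite: KrizLi2019, Thm. 1.12, Thm. 5.1] -/
@[conjecture] def DescentSignHeegnerIndexAtTwo : Prop :=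
  ∀ (W : WeierstrassCurve ℚ) [W.IsElliptic] [W.IsGloballyMinimal] [NeZero (W.conductorNorm ℤ)],
    0 < W.Δ → NoRationalTwoTorsion W → W.mordellWeilRank = 1 → ShaTwoTrivial W →
    ∀ (K : Type) [Field K] [NumberField K], IsImaginaryQuadratic K →
      DescAdmissible W (NumberField.discr K) →
      (W.quadraticTwist (NumberField.discr K : ℚ)).mordellWeilRank = 0 →
      ∀ (Dt : ModularParametrizationData W (W.conductorNorm ℤ))
        (H : HeegnerDatum (W.conductorNorm ℤ) (NumberField.discr K)) (ι : K →+* ℂ)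
        (P : (W.baseChange K).toAffine.Point),
        WeierstrassCurve.Affine.Point.map ι.toRatAlgHom P = heegnerPointComplex Dt H →
        ¬ IsOfFinAddOrder P →
          (MeetsEgg W ↔
            padicValNat 2 (AddSubgroup.zmultiples P ⊔ AddCommGroup.torsion (W.baseChange K).toAffine.Point).index =
              padicValNat 2 (Dt.c.natAbs * W.tamagawaProduct))

/-- **AN-10H⁻ `DescentSignHeegnerDivisibilityAtTwo` (the one-sided, sharper half; conjecture).** Same hypotheses; if the
generator of `E(ℚ)` misses the egg (`ε = −1`) then the Heegner point is 2-divisible beyond Tamagawa: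
`2 · |c| · 2^{v₂ Tam(E)} ∣ I(P)`, i.e. `v₂ I(P) ≥ v₂(c · Tam(E)) + 1`. (Given GZ V.(2.2) at 2 this is AN-10K:
`ε = −1 ⇒ 4 ∣ #Ш(E/K)`.) REF1 §25 remark (2): this half is STRONGER than the `←` direction of AN-10H — it contains the
2-part of the integrality `c·Tam(E) ∣ I_K` (`= √#Ш(E/K) ∈ ℤ`), conjectural at `2` (Jetchev 2008's global divisibility of
the Heegner index by Tamagawa numbers is a theorem for odd `p`, `p ∤ N`, `GL₂`-image); it is kept as its own obligation
and is NOT a corollary of AN-10H. Census: `2^{v₂(|c|·Tam)+1} ∣ I` on 580/580 `ε = −1` admissible pairs (`N ≤ 20 000`);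
Jetchev-at-2 inequality `v₂ I_K ≥ v₂(c·Tam(E))` on every certified row (634/634 quick tranche). REF2 v12 §2:
in-print-assembly conjecture-grade; P-ODD-ONLY as a theorem; no printed `p = 2` theorem on the `ε = −1` side.
[cite: GrossZagier1986, V.(2.2)] [cite: Kramer1981, Thm. 1, Prop. 6] [cite: Jetchev2008, Thm. 1.4] -/
@[conjecture] def DescentSignHeegnerDivisibilityAtTwo : Prop :=
  ∀ (W : WeierstrassCurve ℚ) [W.IsElliptic] [W.IsGloballyMinimal] [NeZero (W.conductorNorm ℤ)],
    0 < W.Δ → NoRationalTwoTorsion W → W.mordellWeilRank = 1 → ShaTwoTrivial W → ¬ MeetsEgg W →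
    ∀ (K : Type) [Field K] [NumberField K], IsImaginaryQuadratic K →
      DescAdmissible W (NumberField.discr K) →
      (W.quadraticTwist (NumberField.discr K : ℚ)).mordellWeilRank = 0 →
      ∀ (Dt : ModularParametrizationData W (W.conductorNorm ℤ))
        (H : HeegnerDatum (W.conductorNorm ℤ) (NumberField.discr K)) (ι : K →+* ℂ)
        (P : (W.baseChange K).toAffine.Point),
        WeierstrassCurve.Affine.Point.map ι.toRatAlgHom P = heegnerPointComplex Dt H →
        ¬ IsOfFinAddOrder P →
          2 ^ (padicValNat 2 (Dt.c.natAbs * W.tamagawaProduct) + 1) ∣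
            (AddSubgroup.zmultiples P ⊔ AddCommGroup.torsion (W.baseChange K).toAffine.Point).index

/-- Bookkeeping (proved): AN-10H⁻ yields the `←` direction of AN-10H wherever the index is non-zero (on the typed locus
`I(P) ≠ 0` follows from rank `E(K) = 1`; it is kept as an explicit hypothesis here) — if `v₂ I(P) = v₂(|c|·Tam(E))` then
the generator meets the egg, because `ε = −1` would force `2^{v₂(|c|·Tam)+1} ∣ I(P)`, i.e. `v₂ I(P) ≥ v₂(|c|·Tam) + 1`.
The `→` direction of AN-10H (`ε = +1 ⇒` the valuations agree) is the independent content not covered by AN-10H⁻. -/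
theorem meetsEgg_of_padicValNat_index_eq (h : DescentSignHeegnerDivisibilityAtTwo)
    (W : WeierstrassCurve ℚ) [W.IsElliptic] [W.IsGloballyMinimal] [NeZero (W.conductorNorm ℤ)]
    (hΔ : 0 < W.Δ) (h2 : NoRationalTwoTorsion W) (hr : W.mordellWeilRank = 1) (hS : ShaTwoTrivial W)
    (K : Type) [Field K] [NumberField K] (hK : IsImaginaryQuadratic K)
    (hd : DescAdmissible W (NumberField.discr K))
    (htw : (W.quadraticTwist (NumberField.discr K : ℚ)).mordellWeilRank = 0)
    (Dt : ModularParametrizationData W (W.conductorNorm ℤ))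
    (H : HeegnerDatum (W.conductorNorm ℤ) (NumberField.discr K)) (ι : K →+* ℂ)
    (P : (W.baseChange K).toAffine.Point)
    (hP : WeierstrassCurve.Affine.Point.map ι.toRatAlgHom P = heegnerPointComplex Dt H)
    (hPinf : ¬ IsOfFinAddOrder P)
    (hI : (AddSubgroup.zmultiples P ⊔ AddCommGroup.torsion (W.baseChange K).toAffine.Point).index ≠ 0)
    (hv : padicValNat 2 (AddSubgroup.zmultiples P ⊔ AddCommGroup.torsion (W.baseChange K).toAffine.Point).index =
      padicValNat 2 (Dt.c.natAbs * W.tamagawaProduct)) :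
    MeetsEgg W := by
  by_contra hne
  have hdvd := h W hΔ h2 hr hS hne K hK hd htw Dt H ι P hP hPinf
  have key := (padicValNat_dvd_iff_le hI).mp hdvd
  omega

end

end Summit.BirchSwinnertonDyer.Rank1Residual.F1Sign2

end
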